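import Mathlib.Analysis.Complex.Basic
import Mathlib.Analysis.Complex.Circle
import Literature.AlgebraicGeometry.Frobenioids.Categories
import HarnessLib

/-!
# Frobenioids II, §3: the base category `D₀` of archimedean primes

Mochizuki, *The geometry of Frobenioids II: poly-Frobenioids*, Kyushu J. Math. **62** (2008)
401–460, §3 "Archimedean Primes", opening paragraph, author's text p. 23 ll. 10–13
[cite: MochizukiFrdII2008, §3 p.23]:

> "Write `D₀` for the subcategory of connected objects of the Galois category of finite étale
> coverings of `Spec(ℝ)` [cf. [Mzk5], §0]. Thus, `D₀` is a connected, totally epimorphic category,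
> which is of FSM-, hence also of FSMFF-type [cf. [Mzk5], §0]."

**Rendering (documented deviation, up to equivalence of categories).** The connected finite étale
`ℝ`-schemes are, up to isomorphism, `Spec ℝ` and `Spec ℂ`; morphisms of `ℝ`-schemes between them are
`Hom(Spec ℂ, Spec ℂ) = Gal(ℂ/ℝ) = {id, conj}`, `Hom(Spec ℂ, Spec ℝ) = {pt}`, `Hom(Spec ℝ, Spec ℝ) = {id}`,
`Hom(Spec ℝ, Spec ℂ) = ∅`. We type `D₀` as this two-object SKELETON `ArchFrd.D0` (objects `.real`,
`.complex`; arrows the inductive family `ArchFrd.D0.Hom`), which is equivalent to the printed category;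
every notion of [FrdI]/[FrdII] used downstream is invariant under equivalence. A morphism
`Spec L → Spec K` corresponds to the field embedding `K ↪ L` (inside `ℂ`), which is complex
conjugation exactly for the non-identity automorphism of `Spec ℂ`; we record this as the Boolean
`Hom.twists` and the induced action `Hom.act` on `ℂˣ` (used by Example 3.3 to form `A_K|_L`).

**Contents / claims.** `D0` with its `Category` instance (laws PROVED); `IsReal`/`IsComplex`;
the nontrivial automorphism `conj : complex ⟶ complex` with `conj ≫ conj = 𝟙` (PROVED) and
"`Aut(Spec ℂ) = {𝟙, conj}`", "`Spec ℝ` has no nontrivial endomorphism" (PROVED, cf. Def. 3.1 (i));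
the scalar groups `K^× ⊆ ℂ^×` and `O_K^× ⊆ ℂ^×` attached to an object (Def. 3.1 (ii), inside `ℂ`);
the printed claims "`D₀` is connected" and "totally epimorphic" PROVED
(`D0.isGraphConnected`, `D0.isTotallyEpimorphic`) and "of FSM-type" PROVED
(`D0.isOfFSMType`). Deliberately NOT here: the identification with Mathlib's `GaloisCategory`
of finite `Gal(ℂ/ℝ)`-sets (not needed downstream); "hence of FSMFF-type" is
`IsOfFSMType.isOfFSMFFType` of `CategoriesFactorization.lean` applied to `isOfFSMType`;
Definition 3.1 (v) (real/complex objects of a category over `D₀`, complexifiable, RC-connected,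
RC-anchors) is abc-iut-L1-t4's `FiniteEtaleBase.lean` (`RC.*` over its non-skeletal `FinEtale ℝ`); the
comparison functor `D0 ⥤ FinEtale ℝ` is supplied in a later file.
-/

namespace Literature.AlgebraicGeometry.Frobenioids

open CategoryTheory

namespace ArchFrd

/-- The base category `D₀` of §3 (FrdII p. 23): connected finite étale coverings of `Spec ℝ`,
rendered by its skeleton with the two objects `Spec ℝ` (`real`) and `Spec ℂ` (`complex`).
(The non-skeletal category of all finite separable extensions of `ℝ` is abc-iut-L1-t4's
`FinEtale ℝ`; a comparison functor is supplied downstream.) [cite: MochizukiFrdII2008, §3 p.23] -/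
inductive D0 : Type
  /-- `Spec ℝ` -/
  | real
  /-- `Spec ℂ` -/
  | complex
  deriving DecidableEq, Inhabited

namespace D0

/-- Morphisms of `D₀` (FrdII p. 23): `Hom(Spec ℝ, Spec ℝ) = {id}`, `Hom(Spec ℂ, Spec ℝ) = {pt}`,
`Hom(Spec ℂ, Spec ℂ) = Gal(ℂ/ℝ)` indexed by a Boolean (`false` = identity, `true` = complex
conjugation), `Hom(Spec ℝ, Spec ℂ) = ∅`. [cite: MochizukiFrdII2008, §3 p.23] -/
inductive Hom : D0 → D0 → Type
  /-- the identity of `Spec ℝ` -/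
  | idReal : Hom real real
  /-- the structure morphism `Spec ℂ → Spec ℝ` -/
  | toReal : Hom complex real
  /-- the element of `Gal(ℂ/ℝ)` acting on `Spec ℂ`; `gal true` is complex conjugation -/
  | gal (σ : Bool) : Hom complex complex
  deriving DecidableEq

/-- Composition in `D₀` (diagrammatic order: first `f : M → L`, then `g : L → K`); on
`Gal(ℂ/ℝ) ≅ ℤ/2ℤ` it is addition (`xor`). [cite: MochizukiFrdII2008, §3 p.23] -/
def Hom.comp : {M L K : D0} → Hom M L → Hom L K → Hom M K
  | _, _, _, .idReal, .idReal => .idReal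
  | _, _, _, .toReal, .idReal => .toReal
  | _, _, _, .gal _, .toReal => .toReal
  | _, _, _, .gal σ, .gal τ => .gal (xor σ τ)

/-- Identities of `D₀`. [cite: MochizukiFrdII2008, §3 p.23] -/
def Hom.id : (K : D0) → Hom K K
  | .real => .idReal
  | .complex => .gal false

/-- `D₀` is a category (laws checked by cases on the finitely many arrows).
[cite: MochizukiFrdII2008, §3 p.23] -/
instance instCategory : Category D0 where
  Hom := Hom
  id := Hom.id
  comp := Hom.comp
  id_comp f := by
    cases f
    · rfl
    · rfl
    · simp only [Hom.id, Hom.comp, Bool.false_xor]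
  comp_id f := by
    cases f
    · rfl
    · rfl
    · simp only [Hom.id, Hom.comp, Bool.xor_false]
  assoc f g h := by
    cases f <;> cases g <;> cases h <;> simp only [Hom.comp, Bool.xor_assoc]

/-- The nontrivial automorphism of `Spec ℂ` in `D₀` (complex conjugation; FrdII Def. 3.1 (i)
p. 23: "the unique nontrivial automorphism of the topological field `ℂ` is given by complex
conjugation"). [cite: MochizukiFrdII2008, Def 3.1 (i) p.23] -/
def conj : complex ⟶ complex := Hom.gal true

/-- The structure morphism `Spec ℂ → Spec ℝ` of `D₀`. [cite: MochizukiFrdII2008, §3 p.23] -/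
def toRealHom : complex ⟶ real := Hom.toReal

/-- `conj ∘ conj = id`. [cite: MochizukiFrdII2008, Def 3.1 (i) p.23] -/
@[simp] theorem conj_comp_conj : conj ≫ conj = 𝟙 complex := rfl

/-- `conj ≠ id`. [cite: MochizukiFrdII2008, Def 3.1 (i) p.23] -/
theorem conj_ne_id : conj ≠ 𝟙 complex := fun h =>
  Bool.noConfusion (Hom.gal.inj (show Hom.gal true = Hom.gal false from h))

/-- "the topological field `ℝ` has no nontrivial automorphisms" (FrdII Def. 3.1 (i) p. 23): every
endomorphism of `Spec ℝ` in `D₀` is the identity. [cite: MochizukiFrdII2008, Def 3.1 (i) p.23] -/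
theorem hom_real_real_eq_id (f : real ⟶ real) : f = 𝟙 real := by
  cases f; rfl

/-- Every endomorphism of `Spec ℂ` in `D₀` is the identity or `conj` (FrdII Def. 3.1 (i) p. 23).
[cite: MochizukiFrdII2008, Def 3.1 (i) p.23] -/
theorem hom_complex_complex_eq (f : complex ⟶ complex) : f = 𝟙 complex ∨ f = conj := by
  cases f with
  | gal σ => cases σ <;> [exact Or.inl rfl; exact Or.inr rfl]

/-- `Hom(Spec ℂ, Spec ℝ)` is a singleton. [cite: MochizukiFrdII2008, §3 p.23] -/
theorem hom_complex_real_eq (f : complex ⟶ real) : f = toRealHom := by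
  cases f; rfl

/-- `Hom(Spec ℝ, Spec ℂ) = ∅` (there is no field embedding `ℂ ↪ ℝ`).
[cite: MochizukiFrdII2008, §3 p.23] -/
theorem isEmpty_hom_real_complex : IsEmpty (real ⟶ complex) :=
  ⟨fun f => by cases f⟩

/-- `Hom(Spec ℝ, Spec ℝ)` has at most one element. [cite: MochizukiFrdII2008, §3 p.23] -/
instance subsingleton_hom_real_real : Subsingleton (real ⟶ real) :=
  ⟨fun f g => by cases f; cases g; rfl⟩

/-- `Hom(Spec ℂ, Spec ℝ)` has at most one element. [cite: MochizukiFrdII2008, §3 p.23] -/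
instance subsingleton_hom_complex_real : Subsingleton (complex ⟶ real) :=
  ⟨fun f g => by cases f; cases g; rfl⟩

/-- `Hom(K, Spec ℝ)` has at most one element. [cite: MochizukiFrdII2008, §3 p.23] -/
instance subsingleton_hom_to_real (K : D0) : Subsingleton (K ⟶ real) := by
  cases K <;> infer_instance

/-- `Hom(Spec ℝ, Spec ℂ)` has at most one element (it is empty). [cite: MochizukiFrdII2008, §3 p.23] -/
instance subsingleton_hom_real_complex : Subsingleton (real ⟶ complex) :=
  ⟨fun f => (isEmpty_hom_real_complex.false f).elim⟩

/-- `Hom(Spec ℝ, K)` has at most one element. [cite: MochizukiFrdII2008, §3 p.23] -/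
instance subsingleton_hom_from_real (K : D0) : Subsingleton (real ⟶ K) := by
  cases K <;> infer_instance

/-- Every arrow of `D₀` with codomain `Spec ℂ` has domain `Spec ℂ`. [cite: MochizukiFrdII2008, §3 p.23] -/
theorem eq_complex_of_hom_complex {L : D0} (f : L ⟶ complex) : L = complex := by
  cases L
  · exact (isEmpty_hom_real_complex.false f).elim
  · rfl

/-! ### Real and complex objects; the Galois twist of an arrow -/

/-- `K` is *real*, i.e. `K = Spec ℝ` (FrdII Def. 3.1 (i)/(v), pp. 23–24).
[cite: MochizukiFrdII2008, Def 3.1 (i) p.23] -/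
def IsReal (K : D0) : Prop := K = real

/-- `K` is *complex*, i.e. `K = Spec ℂ` (FrdII Def. 3.1 (i)/(v), pp. 23–24).
[cite: MochizukiFrdII2008, Def 3.1 (i) p.23] -/
def IsComplex (K : D0) : Prop := K = complex

/-- Being real is decidable. [cite: MochizukiFrdII2008, Def 3.1 (i) p.23] -/
instance decidableIsReal (K : D0) : Decidable K.IsReal :=
  inferInstanceAs (Decidable (K = real))

/-- Being complex is decidable. [cite: MochizukiFrdII2008, Def 3.1 (i) p.23] -/
instance decidableIsComplex (K : D0) : Decidable K.IsComplex :=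
  inferInstanceAs (Decidable (K = complex))

/-- Every object of `D₀` is real or complex. [cite: MochizukiFrdII2008, Def 3.1 (i) p.23] -/
theorem isReal_or_isComplex (K : D0) : K.IsReal ∨ K.IsComplex := by
  cases K <;> [exact Or.inl rfl; exact Or.inr rfl]

/-- Whether the field embedding `K ↪ L ⊆ ℂ` underlying `f : Spec L → Spec K` is complex
conjugation (`true` exactly for `conj`). [cite: MochizukiFrdII2008, Def 3.1 (i) p.23] -/
def Hom.twists : {L K : D0} → (L ⟶ K) → Bool
  | _, _, .gal σ => σ
  | _, _, .idReal => false
  | _, _, .toReal => false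

/-- Identities do not twist. [cite: MochizukiFrdII2008, Def 3.1 (i) p.23] -/
@[simp] theorem twists_id (K : D0) : Hom.twists (𝟙 K) = false := by cases K <;> rfl

/-- `conj` twists. [cite: MochizukiFrdII2008, Def 3.1 (i) p.23] -/
@[simp] theorem twists_conj : Hom.twists conj = true := rfl

/-- The twist of a Galois element is its Boolean. [cite: MochizukiFrdII2008, Def 3.1 (i) p.23] -/
@[simp] theorem twists_gal (σ : Bool) : Hom.twists (Hom.gal σ) = σ := rfl

/-- `Spec ℂ → Spec ℝ` does not twist (the embedding `ℝ ↪ ℂ` is the inclusion).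
[cite: MochizukiFrdII2008, Def 3.1 (i) p.23] -/
@[simp] theorem twists_toRealHom : Hom.twists toRealHom = false := rfl

/-- An arrow into `Spec ℝ` never twists. [cite: MochizukiFrdII2008, §3 p.23] -/
@[simp] theorem twists_of_real {L : D0} (f : L ⟶ real) : Hom.twists f = false := by
  cases f <;> rfl

/-- Twists add under composition when the final codomain is `Spec ℂ`.
[cite: MochizukiFrdII2008, §3 p.23] -/
@[simp] theorem twists_comp_complex {M L : D0} (f : M ⟶ L) (g : L ⟶ complex) :
    Hom.twists (f ≫ g) = xor (Hom.twists f) (Hom.twists g) := by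
  cases g; cases f; rfl

/-- The Galois action on `ℂ^×` attached to a Boolean twist: identity or complex conjugation
(`star` on `ℂˣ`). [cite: MochizukiFrdII2008, Def 3.1 (i) p.23] -/
noncomputable def galAct (σ : Bool) : ℂˣ ≃* ℂˣ := bif σ then starMulEquiv else MulEquiv.refl ℂˣ
  where
  /-- complex conjugation as a multiplicative automorphism of `ℂˣ` -/
  starMulEquiv : ℂˣ ≃* ℂˣ :=
    { toFun := star, invFun := star, left_inv := star_star, right_inv := star_star,
      map_mul' := fun a b => by rw [star_mul, mul_comm] }

/-- The trivial twist acts identically. [cite: MochizukiFrdII2008, Def 3.1 (i) p.23] -/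
@[simp] theorem galAct_false (u : ℂˣ) : galAct false u = u := rfl

/-- The nontrivial twist acts by complex conjugation. [cite: MochizukiFrdII2008, Def 3.1 (i) p.23] -/
@[simp] theorem galAct_true (u : ℂˣ) : galAct true u = star u := rfl

/-- The Galois action is involutive. [cite: MochizukiFrdII2008, Def 3.1 (i) p.23] -/
@[simp] theorem galAct_galAct (σ : Bool) (u : ℂˣ) : galAct σ (galAct σ u) = u := by
  cases σ <;> simp

/-- The Galois action is additive in the twist (`Gal(ℂ/ℝ) ≅ ℤ/2ℤ`).
[cite: MochizukiFrdII2008, Def 3.1 (i) p.23] -/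
theorem galAct_xor (σ τ : Bool) (u : ℂˣ) : galAct (xor σ τ) u = galAct τ (galAct σ u) := by
  cases σ <;> cases τ <;> simp

/-- The two Galois twists commute (`Gal(ℂ/ℝ)` is abelian). [cite: MochizukiFrdII2008, Def 3.1 (i) p.23] -/
theorem galAct_comm (σ τ : Bool) (u : ℂˣ) : galAct σ (galAct τ u) = galAct τ (galAct σ u) := by
  cases σ <;> cases τ <;> simp

/-- The image of a set under the trivial twist is itself. [cite: MochizukiFrdII2008, Def 3.1 (i) p.23] -/
@[simp] theorem image_galAct_false (S : Set ℂˣ) : galAct false '' S = S := by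
  ext x; simp

/-- The Galois action preserves absolute values. [cite: MochizukiFrdII2008, Def 3.1 (ii) p.23] -/
@[simp] theorem norm_galAct (σ : Bool) (u : ℂˣ) : ‖((galAct σ u : ℂˣ) : ℂ)‖ = ‖(u : ℂ)‖ := by
  cases σ
  · rfl
  · rw [galAct_true, Units.coe_star]
    exact Complex.norm_conj _

/-- The action of an arrow `f : Spec L → Spec K` of `D₀` on scalars: `x ↦ ι(x)` for the field
embedding `ι : K ↪ L` inside `ℂ` (identity or conjugation). [cite: MochizukiFrdII2008, Def 3.1 (i) p.23] -/
noncomputable abbrev Hom.act {L K : D0} (f : L ⟶ K) : ℂˣ ≃* ℂˣ := galAct (Hom.twists f)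

/-! ### Scalars of an object inside `ℂ` (Definition 3.1 (ii) read inside `ℂ`) -/

/-- `K^× ⊆ ℂ^×`: the nonzero scalars of the archimedean local field of `K` (`ℝ^×` for `Spec ℝ`,
`ℂ^×` for `Spec ℂ`). [cite: MochizukiFrdII2008, Def 3.1 (ii) p.23] -/
def scalars : D0 → Subgroup ℂˣ
  | real => (Units.map Complex.ofRealHom.toMonoidHom).range
  | complex => ⊤

/-- `ℂ^×` is all of `ℂ^×`. [cite: MochizukiFrdII2008, Def 3.1 (ii) p.23] -/
@[simp] theorem scalars_complex : scalars complex = ⊤ := rfl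

/-- Membership in `ℝ^× ⊆ ℂ^×`: the imaginary part vanishes. [cite: MochizukiFrdII2008, Def 3.1 (ii) p.23] -/
theorem mem_scalars_real_iff (u : ℂˣ) : u ∈ scalars real ↔ (u : ℂ).im = 0 := by
  constructor
  · rintro ⟨r, rfl⟩
    exact Complex.ofReal_im (r : ℝ)
  · intro h
    have hre : (u : ℂ).re ≠ 0 := by
      intro hre
      exact u.ne_zero (Complex.ext hre h)
    refine ⟨Units.mk0 (u : ℂ).re hre, Units.ext ?_⟩
    change (((u : ℂ).re : ℝ) : ℂ) = (u : ℂ)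
    exact Complex.ext (by simp) (by simp [h])

/-- `O_K^× ⊆ ℂ^×`: the scalars of `K` of norm `1` (`{±1}` for `Spec ℝ`, `S¹` for `Spec ℂ`;
FrdII Def. 3.1 (ii), p. 23). [cite: MochizukiFrdII2008, Def 3.1 (ii) p.23] -/
def unitScalars (K : D0) : Subgroup ℂˣ where
  carrier := {u | u ∈ scalars K ∧ ‖(u : ℂ)‖ = 1}
  mul_mem' {a b} ha hb := ⟨mul_mem ha.1 hb.1, by rw [Units.val_mul, norm_mul, ha.2, hb.2, mul_one]⟩
  one_mem' := ⟨one_mem _, by simp⟩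
  inv_mem' {a} ha := ⟨inv_mem ha.1, by rw [Units.val_inv_eq_inv_val, norm_inv, ha.2, inv_one]⟩

/-- Membership in `O_K^×`. [cite: MochizukiFrdII2008, Def 3.1 (ii) p.23] -/
theorem mem_unitScalars_iff (K : D0) (u : ℂˣ) :
    u ∈ unitScalars K ↔ u ∈ scalars K ∧ ‖(u : ℂ)‖ = 1 := Iff.rfl

/-- Scalars are stable under the Galois action of any arrow. [cite: MochizukiFrdII2008, Def 3.1 (ii) p.23] -/
theorem galAct_mem_scalars (σ : Bool) {K : D0} {u : ℂˣ} (hu : u ∈ scalars K) :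
    galAct σ u ∈ scalars K := by
  cases σ
  · exact hu
  · cases K
    · rw [mem_scalars_real_iff] at hu ⊢
      simp [hu]
    · trivial

/-- Real scalars are fixed by the Galois action. [cite: MochizukiFrdII2008, Def 3.1 (i) p.23] -/
theorem galAct_eq_self_of_mem_scalars_real (σ : Bool) {u : ℂˣ} (hu : u ∈ scalars real) :
    galAct σ u = u := by
  cases σ
  · rfl
  · rw [mem_scalars_real_iff] at hu
    ext : 1
    rw [galAct_true, Units.coe_star]
    exact Complex.conj_eq_iff_im.mpr hu

/-! ### The printed claims about `D₀` (p. 23) -/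

/-- "`D₀` is a connected … category" (FrdII p. 23): PROVED (the arrow `Spec ℂ → Spec ℝ` joins the
two objects). [cite: MochizukiFrdII2008, §3 p.23] -/
theorem isGraphConnected : IsGraphConnected D0 := by
  refine ⟨⟨real⟩, fun X Y => ?_⟩
  have h : ∀ K : D0, Zigzag K real := fun K => by
    cases K
    · exact Zigzag.refl _
    · exact Zigzag.of_hom toRealHom
  exact (h X).trans (h Y).symm

/-- "`D₀` is a … totally epimorphic category" (FrdII p. 23): PROVED by cases.
[cite: MochizukiFrdII2008, §3 p.23] -/
theorem isTotallyEpimorphic : IsTotallyEpimorphic D0 := by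
  refine ⟨fun {A B} f => ⟨fun {Z} g h hgh => ?_⟩⟩
  cases f with
  | idReal => simpa using (show 𝟙 real ≫ g = 𝟙 real ≫ h from hgh)
  | toReal => exact Subsingleton.elim _ _
  | gal σ =>
    cases Z
    · exact Subsingleton.elim _ _
    · cases g with
      | gal τ => cases h with
        | gal τ' =>
          have e : xor σ τ = xor σ τ' := Hom.gal.inj hgh
          cases σ <;> cases τ <;> cases τ' <;> simp_all

/-- The structure morphism `Spec ℂ → Spec ℝ` is not a monomorphism (`𝟙 ≫ toReal = conj ≫ toReal`).
[cite: MochizukiFrdII2008, §3 p.23] -/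
theorem not_mono_toRealHom : ¬ Mono toRealHom := by
  intro h
  have e : (𝟙 complex : complex ⟶ complex) = conj :=
    h.right_cancellation (𝟙 complex) conj (Subsingleton.elim _ _)
  exact conj_ne_id e.symm

/-- Every monomorphism of `D₀` is an isomorphism. [cite: MochizukiFrdII2008, §3 p.23] -/
theorem isIso_of_mono {A B : D0} (f : A ⟶ B) [hf : Mono f] : IsIso f := by
  cases f with
  | idReal => exact (inferInstance : IsIso (𝟙 real))
  | toReal => exact absurd hf not_mono_toRealHom
  | gal σ => exact ⟨⟨Hom.gal σ, by cases σ <;> rfl, by cases σ <;> rfl⟩⟩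

/-- "`D₀` … is of FSM-type" (FrdII p. 23): PROVED — every monomorphism of `D₀` is already an
isomorphism. ("hence also of FSMFF-type" is `IsOfFSMType.isOfFSMFFType`.)
[cite: MochizukiFrdII2008, §3 p.23] -/
theorem isOfFSMType : IsOfFSMType D0 :=
  ⟨fun f hf => by haveI := hf.2; exact isIso_of_mono f⟩

end D0

end ArchFrd

end Literature.AlgebraicGeometry.Frobenioids
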